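import Summits.QuantumFields.YangMills.Theorems.TwistedTraceScaling.Negative.ShellWitnessBelowThreshold
import HarnessLib

/-!
# Negative lemma R25 (crux `TwistedTraceScaling`, stmt-QuantumFields-20203): the EXPONENT WINDOW of lane A's one-site route to the two-zone C4 —
# the four typed bookkeeping constraints on the common core/shell exponent `s` hold together iff `1/6 < s < min(a, 2/9)` (`a` = one-site threshold
# exponent); at the typed `a = 1/5` the window is `(1/6, 1/5)` and the record `s = 1/5` is excluded; `s = 1/6` is excluded by the budget's `∀κ`

Standing disprover `ym-cdisprove-20203-1` (gen 20).  One kernel-checked window theorem assembling the lineage's certified lines (R21 `…ModelPerturbedNearRigidity`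
§Budget, R22 `…ShellIsValleyBelowLine` §Window, R23 `…OneSiteGainWindow` §Gain, R24b `…ShellWitnessBelowThreshold` §4–§5) for the architecture of record of
lane A (ym-luscher-20007-p1 g11 FINAL, COARSE-DESIGN §21–§22; glue `coarseNoIntruderAt_of_package_shellSmall_pow (hs0 : 0 < s) (hs : s < 1/3)` with ONE exponent `s`
shared by CORE `InnerBOPackageAt L (powScale s)` and SHELL `InnerShellGainSmallAt L (powScale s) (powScale (1/40)) (powScale (17/20))`, the shell discharged through
`oneSite_shell_gain` (threshold `B^{−1/5} ≤ t`, `B = L³β`) and the cells of §22.6).  The four constraints, as typed predicates on `s`: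
* BUDGET(s) — the off-diagonal Feshbach budget of the core package is met by a box-uniform first-order size `b ≍ κ·β^{−s}` for ALL constants `κ, ε, θ > 0`
  (R21/R22: true for `1/6 < s`, false for `s < 1/6`; NEW here: false AT `s = 1/6` once `κ` is quantified — `offDiag_budget_one_sixth_iff`: at `s = 1/6` it holds iff
  `16κ² ≤ εθ(2/L³)^{1/3}`, and `(2/L³)^{1/3} ≤ 2 < 16`);  `offDiag_budget_forall_iff : BUDGET(s) ↔ 1/6 < s`.
* UNITS(s, a) — the one-site image of the shell witness `V*` of R24b (per-link angle `T = π·β^{−s}/(2√2·L³)`) clears a one-site threshold `(L³β)^{−a}` eventually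
  (R24b: `a = 1/5`; NEW here for every `a ≤ 3/4`, which contains the one-site theorem's whole range `a ≤ 1/4`):  `threshold_units_iff : UNITS(s,a) ↔ s < a` for EVERY `L ≥ 2`
  (β-free core: `π/(2√2·L³) < (L³)^{−a}`, `axis_const_lt_threshold_const_of_le`); with an inflated radius `K·β^{−s}` at equal exponents the condition is the β-free
  `2√2·L³(L³)^{−s}/π ≤ K` (`threshold_units_equal_exponent_iff`; at `s = 1/5`: `K ≥ (2√2/π)·L^{12/5}`).
* GAIN(s) — the innermost one-site cell gain `β^{−3s/2}/40` dominates every multiple of `λ_b(L³β)` (R23 `oneSite_gain_dominates_iff : GAIN(s) ↔ s < 2/9`).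
* CUT(s) — `ScalesAdmissible L (powScale s) (powScale s)` (lane A `scalesAdmissible_powScale`: `0 < s < 1/3`; R22: false for `1/3 ≤ s`).
MAIN (`oneSiteRoute_window_iff`): for `L ≥ 2`, `a ≤ 3/4`:  BUDGET(s) ∧ UNITS(s,a) ∧ GAIN(s) ∧ CUT(s) ↔ 1/6 < s ∧ s < a ∧ s < 2/9.  Corollaries: typed threshold `a = 1/5` ⇒
window `(1/6, 1/5)` (`…_typed_iff`; the record `s = 1/5` FAILS, `record_fifth_not_in_window`; `3/16`, `4/21` PASS, `three_sixteenths_in_window`); best one-site threshold `a = 1/4`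
⇒ `(1/6, 2/9)` (`…_quarter_iff`); the pointwise-cell stiff layer `|w|² ≤ β^{−q}` must have `q > (9s+2)/4` (`cell_layer_iff`; `59/64`, `13/14`, `19/20` at `s = 3/16, 4/21, 1/5`).
READING.  These are the ROUTE's own bookkeeping constraints as typed (which `s` the one-site/cell discharge of the two-zone glue can use), NOT truth conditions of
`InnerBOPackageAt` / `InnerShellGainSmallAt` (plausibly true for every `0 < s < 1/3`); the successor (g12, GaugeSlice/§23) may change the architecture — the window binds any
line that keeps `oneSite_shell_gain` (threshold `B^{−a}`) + a common exponent `s` + the shell witness geometry.  Options it leaves: `s ∈ (1/6, 1/5)` as typed; or a threshold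
exponent `a ∈ (1/5, 1/4]` (window `(1/6, min(a,2/9))`); or a constant `K ≥ (2√2/π)L^{12/5}` in both radii (then the glue needs `ScalesAdmissible` for `K·powScale s`).
HONEST FRAMING: negative/tightness bookkeeping (real-exponent arithmetic over certified lemmas) about the bricks of stub S-BASE (C4) of a child of the CONDITIONAL reduction
route R2b1; nothing here is `¬TwistedTraceScaling`, nothing is a gap, nothing is Clay.  Not Mathlib material: project-specific bookkeeping.
-/

set_option autoImplicit false

noncomputable section

open Real
open Literature.MathematicalPhysics.QuantumFieldTheory
open Literature.MathematicalPhysics.QuantumLattice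
open Summit.QuantumFields.YangMills.Theorems.FemtoTransferGap

namespace Summit.QuantumFields.YangMills.Theorems.TwistedTraceScaling.Negative.R25

/-! ## §1 BUDGET(s): the off-diagonal budget with the constants quantified — closed exactly at `1/6 < s` -/

section Budget

variable {L : ℕ} [NeZero L]

/-- `(2/L³)^{1/3} ≤ 2` for every `L ≥ 1`. [folklore] -/
theorem two_div_cube_rpow_third_le_two : (2 / (L : ℝ) ^ 3) ^ ((1 : ℝ) / 3) ≤ 2 := by
  have hL1 : (1 : ℝ) ≤ L := by exact_mod_cast Nat.one_le_iff_ne_zero.mpr (NeZero.ne L)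
  have hL3 : (1 : ℝ) ≤ (L : ℝ) ^ 3 := one_le_pow₀ hL1
  have hL0 : (0 : ℝ) < (L : ℝ) ^ 3 := by positivity
  have h2 : 2 / (L : ℝ) ^ 3 ≤ 2 := by
    rw [div_le_iff₀ hL0]
    nlinarith
  have h0 : (0 : ℝ) ≤ 2 / (L : ℝ) ^ 3 := by positivity
  calc (2 / (L : ℝ) ^ 3) ^ ((1 : ℝ) / 3) ≤ (2 : ℝ) ^ ((1 : ℝ) / 3) := Real.rpow_le_rpow h0 h2 (by norm_num)
    _ ≤ (2 : ℝ) ^ (1 : ℝ) := Real.rpow_le_rpow_of_exponent_le (by norm_num) (by norm_num)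
    _ = 2 := Real.rpow_one 2

/-- ★ **At the borderline exponent `s = 1/6` the budget is a condition on the CONSTANTS**: for `κ > 0`, a box-uniform first-order `b ≥ κ·β^{−1/6}` meets
`b² ≤ εθ·λ_b(L³β)/16` eventually iff `16κ² ≤ εθ·(2/L³)^{1/3}` (R21 `offDiag_budget_at_one_sixth` is the «if»; the «only if» is the same β-free comparison read backwards,
`λ_b(L³β) = (2/L³)^{1/3}β^{−1/3}`). [cite: Luscher1983, §3] -/
theorem offDiag_budget_one_sixth_iff {κ ε θ : ℝ} (hκ : 0 < κ) :
    (∃ β0 : ℝ, ∀ β : ℝ, β0 ≤ β → ∃ b : ℝ, κ * powScale (1 / 6) β ≤ b ∧ b ^ 2 ≤ ε * θ * bareLambda ((L : ℝ) ^ 3 * β) / 16) ↔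
      16 * κ ^ 2 ≤ ε * θ * (2 / (L : ℝ) ^ 3) ^ ((1 : ℝ) / 3) := by
  constructor
  · rintro ⟨β0, h⟩
    obtain ⟨b, hb, hb2⟩ := h (max β0 1) (le_max_left _ _)
    have hβ1 : (1 : ℝ) ≤ max β0 1 := le_max_right _ _
    have hβ0' : (0 : ℝ) < max β0 1 := by linarith
    have hps := powScale_pos (1 / 6) (max β0 1)
    have hsq : (κ * powScale (1 / 6) (max β0 1)) ^ 2 ≤ b ^ 2 := pow_le_pow_left₀ (mul_pos hκ hps).le hb 2
    rw [mul_pow, R21.powScale_sq, powScale_eq hβ1] at hsq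
    rw [bareLambda_cube_eq (L := L) hβ0'] at hb2
    have e' : (max β0 1) ^ (-(2 * (1 / 6) : ℝ)) = (max β0 1) ^ (-(1 : ℝ) / 3) := by
      congr 1
      norm_num
    rw [e'] at hsq
    have hx : 0 < (max β0 1) ^ (-(1 : ℝ) / 3) := Real.rpow_pos_of_pos hβ0' _
    have e2 : ε * θ * ((2 / (L : ℝ) ^ 3) ^ ((1 : ℝ) / 3) * (max β0 1) ^ (-(1 : ℝ) / 3)) / 16 =
        ε * θ * (2 / (L : ℝ) ^ 3) ^ ((1 : ℝ) / 3) / 16 * (max β0 1) ^ (-(1 : ℝ) / 3) := by ring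
    have key : κ ^ 2 * (max β0 1) ^ (-(1 : ℝ) / 3) ≤ ε * θ * (2 / (L : ℝ) ^ 3) ^ ((1 : ℝ) / 3) / 16 * (max β0 1) ^ (-(1 : ℝ) / 3) := by
      linarith
    have := le_of_mul_le_mul_right key hx
    linarith
  · intro h
    exact ⟨1, fun β hβ => R21.offDiag_budget_at_one_sixth L h hβ⟩

/-- ★★ **BUDGET(s) ↔ 1/6 < s.**  The off-diagonal Feshbach budget of `InnerBOPackageAt L (powScale s)` is met by a box-uniform first-order size `b ≥ κ·β^{−s}` for ALL
constants `κ, ε, θ > 0` iff `1/6 < s`: above `1/6` by R22 `offDiag_budget_of_one_sixth_lt`; below by R21 `offDiag_budget_false_of_first_order`; AT `1/6` the constants fight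
(`offDiag_budget_one_sixth_iff` with `κ = ε = θ = 1`: `16 ≤ (2/L³)^{1/3} ≤ 2` is false). [cite: Luscher1983, §3] -/
theorem offDiag_budget_forall_iff {s : ℝ} :
    (∀ κ ε θ : ℝ, 0 < κ → 0 < ε → 0 < θ → ∃ β0 : ℝ, ∀ β : ℝ, β0 ≤ β →
        ∃ b : ℝ, κ * powScale s β ≤ b ∧ b ^ 2 ≤ ε * θ * bareLambda ((L : ℝ) ^ 3 * β) / 16) ↔ 1 / 6 < s := by
  constructor
  · intro h
    rcases lt_trichotomy s (1 / 6) with hlt | heq | hgt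
    · exact absurd (h 1 1 1 one_pos one_pos one_pos) (R21.offDiag_budget_false_of_first_order L hlt one_pos 1 1)
    · subst heq
      have h16 := (offDiag_budget_one_sixth_iff (L := L) (ε := 1) (θ := 1) one_pos).1 (h 1 1 1 one_pos one_pos one_pos)
      have h2 := two_div_cube_rpow_third_le_two (L := L)
      simp only [one_pow, mul_one, one_mul] at h16
      linarith
    · exact hgt
  · intro hs κ ε θ _ hε hθ
    exact R22.offDiag_budget_of_one_sixth_lt L hs κ hε hθ

end Budget

/-! ## §2 UNITS(s, a): the shell witness' one-site radius versus a one-site threshold `(L³β)^{−a}` — closed exactly at `s < a`, every `L ≥ 2` -/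

section Units

/-- The β-free comparison for a general threshold exponent: `π/(2√2·L³) < (L³)^{−a}` for every `L ≥ 2` and every `a ≤ 3/4`
(`π/(2√2) < 3/2 ≤ 8^{1/4} ≤ (L³)^{1−a}`; R24b `axis_const_lt_threshold_const` is `a = 1/5`). [folklore] -/
theorem axis_const_lt_threshold_const_of_le {L : ℕ} (hL : 2 ≤ L) {a : ℝ} (ha : a ≤ 3 / 4) :
    Real.pi / (2 * Real.sqrt 2 * (L : ℝ) ^ 3) < ((L : ℝ) ^ 3) ^ (-a) := by
  have hL2 : (2 : ℝ) ≤ L := by exact_mod_cast hL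
  have hL0 : (0 : ℝ) < (L : ℝ) ^ 3 := by positivity
  have h8 : (8 : ℝ) ≤ (L : ℝ) ^ 3 := by
    have h := pow_le_pow_left₀ (by norm_num : (0 : ℝ) ≤ 2) hL2 3
    norm_num at h
    linarith
  have hL1 : (1 : ℝ) ≤ (L : ℝ) ^ 3 := by linarith
  set u := ((L : ℝ) ^ 3) ^ (1 / 4 : ℝ) with hu
  have hu0 : 0 < u := Real.rpow_pos_of_pos hL0 _
  have hu4 : u ^ (4 : ℕ) = (L : ℝ) ^ 3 := by
    rw [hu, ← Real.rpow_natCast, ← Real.rpow_mul hL0.le]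
    norm_num
  -- `u ≥ 3/2` since `(3/2)⁴ < 8 ≤ u⁴`
  have hu32 : (3 / 2 : ℝ) ≤ u := by
    by_contra hlt
    have hlt' : u < 3 / 2 := lt_of_not_ge hlt
    have : u ^ (4 : ℕ) < (3 / 2 : ℝ) ^ (4 : ℕ) := pow_lt_pow_left₀ hlt' hu0.le (by norm_num)
    rw [hu4] at this
    norm_num at this
    linarith
  have hmono : u ≤ ((L : ℝ) ^ 3) ^ (1 - a) := by
    rw [hu]
    exact Real.rpow_le_rpow_of_exponent_le hL1 (by linarith)
  have hsplit : ((L : ℝ) ^ 3) ^ (1 - a) = (L : ℝ) ^ 3 * ((L : ℝ) ^ 3) ^ (-a) := by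
    rw [Real.rpow_sub hL0, Real.rpow_one, Real.rpow_neg hL0.le, div_eq_mul_inv]
  have hv : (3 / 2 : ℝ) ≤ (L : ℝ) ^ 3 * ((L : ℝ) ^ 3) ^ (-a) := by
    rw [← hsplit]
    exact hu32.trans hmono
  have hs2 : Real.sqrt 2 ^ 2 = 2 := Real.sq_sqrt (by norm_num)
  have hs0 : 0 ≤ Real.sqrt 2 := Real.sqrt_nonneg 2
  have h14 : (7 / 5 : ℝ) ≤ Real.sqrt 2 := by nlinarith
  have hπ := Real.pi_le_four
  rw [div_lt_iff₀ (by positivity)]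
  have e : ((L : ℝ) ^ 3) ^ (-a) * (2 * Real.sqrt 2 * (L : ℝ) ^ 3) = 2 * Real.sqrt 2 * ((L : ℝ) ^ 3 * ((L : ℝ) ^ 3) ^ (-a)) := by ring
  rw [e]
  have h21 : (21 / 5 : ℝ) ≤ 2 * Real.sqrt 2 * ((L : ℝ) ^ 3 * ((L : ℝ) ^ 3) ^ (-a)) := by
    have h1 : 2 * (7 / 5 : ℝ) ≤ 2 * Real.sqrt 2 := by linarith
    have := mul_le_mul h1 hv (by norm_num) (by positivity)
    linarith
  linarith

/-- ★ For `a ≤ 3/4`, `a ≤ s`, EVERY `L ≥ 2` and EVERY `β ≥ 1`: the witness' per-link angle `T = π·β^{−s}/(2√2·L³)` is STRICTLY BELOW the threshold `(L³β)^{−a}`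
(R24b `witness_radius_lt_threshold` is `a = 1/5`). [folklore] -/
theorem axis_radius_lt_threshold {L : ℕ} (hL : 2 ≤ L) {a s : ℝ} (ha : a ≤ 3 / 4) (has : a ≤ s) {β : ℝ} (hβ : 1 ≤ β) :
    Real.pi * powScale s β / (2 * Real.sqrt 2 * (L : ℝ) ^ 3) < ((L : ℝ) ^ 3 * β) ^ (-a) := by
  have hL2 : (2 : ℝ) ≤ L := by exact_mod_cast hL
  have hL0 : (0 : ℝ) < (L : ℝ) ^ 3 := by positivity
  have hβ0 : 0 < β := by linarith
  have hb : 0 < β ^ (-a) := Real.rpow_pos_of_pos hβ0 _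
  rw [Real.mul_rpow hL0.le hβ0.le, powScale_eq hβ]
  have hmono : β ^ (-s) ≤ β ^ (-a) := Real.rpow_le_rpow_of_exponent_le hβ (by linarith)
  have hc := axis_const_lt_threshold_const_of_le hL ha
  have hpos : 0 < Real.pi / (2 * Real.sqrt 2 * (L : ℝ) ^ 3) := by positivity
  calc Real.pi * β ^ (-s) / (2 * Real.sqrt 2 * (L : ℝ) ^ 3)
      = Real.pi / (2 * Real.sqrt 2 * (L : ℝ) ^ 3) * β ^ (-s) := by ring
    _ ≤ Real.pi / (2 * Real.sqrt 2 * (L : ℝ) ^ 3) * β ^ (-a) := mul_le_mul_of_nonneg_left hmono hpos.le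
    _ < ((L : ℝ) ^ 3) ^ (-a) * β ^ (-a) := mul_lt_mul_of_pos_right hc hb

/-- Conversely `s < a` clears the threshold eventually: `(L³β)^{−a} ≤ T(β)` for `β ≥ β0(L, s, a)` (any `L ≥ 1`). [folklore] -/
theorem threshold_le_axis_radius_eventually {L : ℕ} [NeZero L] {a s : ℝ} (hsa : s < a) :
    ∃ β0 : ℝ, ∀ β : ℝ, β0 ≤ β → ((L : ℝ) ^ 3 * β) ^ (-a) ≤ Real.pi * powScale s β / (2 * Real.sqrt 2 * (L : ℝ) ^ 3) := by
  have hL1 : (0 : ℝ) < L := by exact_mod_cast Nat.pos_of_ne_zero (NeZero.ne L)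
  have hL0 : (0 : ℝ) < (L : ℝ) ^ 3 := by positivity
  have hD : 0 < Real.pi / (2 * Real.sqrt 2 * (L : ℝ) ^ 3) := by positivity
  obtain ⟨β0, h⟩ := R23.mul_powScale_le_eventually (a := a) (b := s) hsa (((L : ℝ) ^ 3) ^ (-a)) hD
  refine ⟨max β0 1, fun β hb => ?_⟩
  have hβ1 : 1 ≤ β := le_trans (le_max_right _ _) hb
  have hβ0' : 0 < β := by linarith
  have h1 := h β (le_trans (le_max_left _ _) hb)
  rw [powScale_eq (p := a) hβ1] at h1
  rw [Real.mul_rpow hL0.le hβ0'.le]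
  calc ((L : ℝ) ^ 3) ^ (-a) * β ^ (-a) ≤ Real.pi / (2 * Real.sqrt 2 * (L : ℝ) ^ 3) * powScale s β := h1
    _ = Real.pi * powScale s β / (2 * Real.sqrt 2 * (L : ℝ) ^ 3) := by ring

/-- ★★ **UNITS(s, a) ↔ s < a** for every `L ≥ 2` and every threshold exponent `a ≤ 3/4` (the one-site theorem's range is `a ≤ 1/4`; typed: `a = 1/5`): the shell witness'
one-site radius clears the threshold `(L³β)^{−a}` eventually iff the core exponent is STRICTLY below the threshold exponent. [folklore] -/
theorem threshold_units_iff {L : ℕ} (hL : 2 ≤ L) {a s : ℝ} (ha : a ≤ 3 / 4) :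
    (∃ β0 : ℝ, ∀ β : ℝ, β0 ≤ β → ((L : ℝ) ^ 3 * β) ^ (-a) ≤ Real.pi * powScale s β / (2 * Real.sqrt 2 * (L : ℝ) ^ 3)) ↔ s < a := by
  haveI : NeZero L := ⟨by omega⟩
  constructor
  · rintro ⟨β0, h⟩
    by_contra hs
    have has : a ≤ s := le_of_not_gt hs
    have h1 := h (max β0 1) (le_max_left _ _)
    have h2 := axis_radius_lt_threshold hL ha has (le_max_right β0 1)
    linarith
  · exact threshold_le_axis_radius_eventually

/-- The β-free form at EQUAL exponents with an inflated core radius `K·β^{−s}`: for `β > 0`, `(L³β)^{−s} ≤ π·(K·β^{−s})/(2√2·L³) ↔ (2√2/π)·L³(L³)^{−s} ≤ K`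
(R24b `threshold_le_iff_const`). [folklore] -/
theorem equal_exponent_const_iff {L : ℕ} [NeZero L] {s K β : ℝ} (hβ : 0 < β) :
    ((L : ℝ) ^ 3 * β) ^ (-s) ≤ Real.pi * (K * β ^ (-s)) / (2 * Real.sqrt 2 * (L : ℝ) ^ 3) ↔
      2 * Real.sqrt 2 * ((L : ℝ) ^ 3 * ((L : ℝ) ^ 3) ^ (-s)) / Real.pi ≤ K := by
  have h := R24.threshold_le_iff_const (L := L) (a := s) (κ := Real.pi * K / (2 * Real.sqrt 2)) hβ
  have hs0 : 0 < Real.sqrt 2 := Real.sqrt_pos.2 (by norm_num)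
  have e : Real.pi * (K * β ^ (-s)) / (2 * Real.sqrt 2 * (L : ℝ) ^ 3) = Real.pi * K / (2 * Real.sqrt 2) * β ^ (-s) / (L : ℝ) ^ 3 := by
    field_simp
  rw [e, h, div_le_iff₀ Real.pi_pos, le_div_iff₀ (by positivity)]
  constructor <;> intro h' <;> linarith

/-- … so with equal exponents the β-dependence cancels: UNITS with core radius `K·β^{−s}` and threshold `(L³β)^{−s}` holds eventually iff `(2√2/π)·L³(L³)^{−s} ≤ K`
(at `s = 1/5`: `K ≥ (2√2/π)·L^{12/5}`, `≥ 4.7` at `L = 2`). [folklore] -/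
theorem threshold_units_equal_exponent_iff {L : ℕ} [NeZero L] {s K : ℝ} :
    (∃ β0 : ℝ, ∀ β : ℝ, β0 ≤ β → ((L : ℝ) ^ 3 * β) ^ (-s) ≤ Real.pi * (K * powScale s β) / (2 * Real.sqrt 2 * (L : ℝ) ^ 3)) ↔
      2 * Real.sqrt 2 * ((L : ℝ) ^ 3 * ((L : ℝ) ^ 3) ^ (-s)) / Real.pi ≤ K := by
  constructor
  · rintro ⟨β0, h⟩
    have h1 := h (max β0 1) (le_max_left _ _)
    have hβ1 : (1 : ℝ) ≤ max β0 1 := le_max_right _ _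
    rw [powScale_eq hβ1] at h1
    exact (equal_exponent_const_iff (by linarith)).1 h1
  · intro hK
    refine ⟨1, fun β hβ => ?_⟩
    rw [powScale_eq hβ]
    exact (equal_exponent_const_iff (by linarith)).2 hK

end Units

/-! ## §3 The window: BUDGET ∧ UNITS ∧ GAIN ∧ CUT ↔ 1/6 < s < min(a, 2/9) -/

section Window

variable {L : ℕ} [NeZero L]

/-- ★★★ **THE EXPONENT WINDOW OF THE ONE-SITE ROUTE.**  For `L ≥ 2` and a one-site threshold exponent `a ≤ 3/4`, the four typed constraints on the common exponent `s` —
BUDGET(s) (core off-diagonal budget for box-uniform first-order `b`, all constants), UNITS(s,a) (shell witness clears the one-site threshold), GAIN(s) (innermost cell gain beats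
every multiple of `λ_b`), CUT(s) (`ScalesAdmissible`) — hold together iff `1/6 < s ∧ s < a ∧ s < 2/9`. [cite: Luscher1983, §3] -/
theorem oneSiteRoute_window_iff (hL : 2 ≤ L) {a : ℝ} (ha : a ≤ 3 / 4) (s : ℝ) :
    ((∀ κ ε θ : ℝ, 0 < κ → 0 < ε → 0 < θ → ∃ β0 : ℝ, ∀ β : ℝ, β0 ≤ β →
          ∃ b : ℝ, κ * powScale s β ≤ b ∧ b ^ 2 ≤ ε * θ * bareLambda ((L : ℝ) ^ 3 * β) / 16) ∧
      (∃ β0 : ℝ, ∀ β : ℝ, β0 ≤ β → ((L : ℝ) ^ 3 * β) ^ (-a) ≤ Real.pi * powScale s β / (2 * Real.sqrt 2 * (L : ℝ) ^ 3)) ∧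
      (∀ M : ℝ, ∃ β0 : ℝ, ∀ β : ℝ, β0 ≤ β → M * bareLambda ((L : ℝ) ^ 3 * β) ≤ powScale (3 * s / 2) β / 40) ∧
      ScalesAdmissible L (powScale s) (powScale s)) ↔
    (1 / 6 < s ∧ s < a ∧ s < 2 / 9) := by
  rw [offDiag_budget_forall_iff (L := L), threshold_units_iff hL ha, R23.oneSite_gain_dominates_iff L]
  constructor
  · rintro ⟨h1, h2, h3, -⟩
    exact ⟨h1, h2, h3⟩
  · rintro ⟨h1, h2, h3⟩
    exact ⟨h1, h2, h3, scalesAdmissible_powScale (by linarith) (by linarith)⟩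

/-- ★★ **Typed threshold `a = 1/5`** (`oneSite_shell_gain`: `B^{−1/5} ≤ t`): the window is `1/6 < s < 1/5` — OPEN at both ends. [cite: Luscher1983, §3] -/
theorem oneSiteRoute_window_typed_iff (hL : 2 ≤ L) (s : ℝ) :
    ((∀ κ ε θ : ℝ, 0 < κ → 0 < ε → 0 < θ → ∃ β0 : ℝ, ∀ β : ℝ, β0 ≤ β →
          ∃ b : ℝ, κ * powScale s β ≤ b ∧ b ^ 2 ≤ ε * θ * bareLambda ((L : ℝ) ^ 3 * β) / 16) ∧
      (∃ β0 : ℝ, ∀ β : ℝ, β0 ≤ β → ((L : ℝ) ^ 3 * β) ^ (-(1 / 5 : ℝ)) ≤ Real.pi * powScale s β / (2 * Real.sqrt 2 * (L : ℝ) ^ 3)) ∧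
      (∀ M : ℝ, ∃ β0 : ℝ, ∀ β : ℝ, β0 ≤ β → M * bareLambda ((L : ℝ) ^ 3 * β) ≤ powScale (3 * s / 2) β / 40) ∧
      ScalesAdmissible L (powScale s) (powScale s)) ↔
    (1 / 6 < s ∧ s < 1 / 5) := by
  rw [oneSiteRoute_window_iff hL (a := 1 / 5) (by norm_num) s]
  constructor
  · rintro ⟨h1, h2, -⟩
    exact ⟨h1, h2⟩
  · rintro ⟨h1, h2⟩
    exact ⟨h1, h2, by linarith⟩

/-- ★ **Best one-site threshold `a = 1/4`** (the binding constraint `t ≥ 100·B^{−1/4}` of `…OneSiteShellGainPrelim`): the window is `1/6 < s < 2/9`, the GAIN bound binding. [cite: Luscher1983, §3] -/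
theorem oneSiteRoute_window_quarter_iff (hL : 2 ≤ L) (s : ℝ) :
    ((∀ κ ε θ : ℝ, 0 < κ → 0 < ε → 0 < θ → ∃ β0 : ℝ, ∀ β : ℝ, β0 ≤ β →
          ∃ b : ℝ, κ * powScale s β ≤ b ∧ b ^ 2 ≤ ε * θ * bareLambda ((L : ℝ) ^ 3 * β) / 16) ∧
      (∃ β0 : ℝ, ∀ β : ℝ, β0 ≤ β → ((L : ℝ) ^ 3 * β) ^ (-(1 / 4 : ℝ)) ≤ Real.pi * powScale s β / (2 * Real.sqrt 2 * (L : ℝ) ^ 3)) ∧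
      (∀ M : ℝ, ∃ β0 : ℝ, ∀ β : ℝ, β0 ≤ β → M * bareLambda ((L : ℝ) ^ 3 * β) ≤ powScale (3 * s / 2) β / 40) ∧
      ScalesAdmissible L (powScale s) (powScale s)) ↔
    (1 / 6 < s ∧ s < 2 / 9) := by
  rw [oneSiteRoute_window_iff hL (a := 1 / 4) (by norm_num) s]
  constructor
  · rintro ⟨h1, -, h3⟩
    exact ⟨h1, h3⟩
  · rintro ⟨h1, h3⟩
    exact ⟨h1, by linarith, h3⟩

/-- ★★ **The record exponent `s = 1/5` is NOT in the typed window** (UNITS fails for every `L ≥ 2`, every `β ≥ 1` — R24b), while `3/16` and `4/21` are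
(margins `1/48, 1/80` and `1/42, 1/105`). [folklore] -/
theorem record_fifth_not_in_window : ¬ ((1 : ℝ) / 6 < 1 / 5 ∧ (1 : ℝ) / 5 < 1 / 5) ∧
    ((1 : ℝ) / 6 < 3 / 16 ∧ (3 : ℝ) / 16 < 1 / 5) ∧ ((1 : ℝ) / 6 < 4 / 21 ∧ (4 : ℝ) / 21 < 1 / 5) ∧
    ((3 : ℝ) / 16 - 1 / 6 = 1 / 48 ∧ (1 : ℝ) / 5 - 3 / 16 = 1 / 80 ∧ (4 : ℝ) / 21 - 1 / 6 = 1 / 42 ∧ (1 : ℝ) / 5 - 4 / 21 = 1 / 105) := by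
  norm_num

/-- The four constraints DO hold together at `s = 3/16` with the typed threshold `a = 1/5`, for every `L ≥ 2`. [folklore] -/
theorem three_sixteenths_in_window (hL : 2 ≤ L) :
    (∀ κ ε θ : ℝ, 0 < κ → 0 < ε → 0 < θ → ∃ β0 : ℝ, ∀ β : ℝ, β0 ≤ β →
          ∃ b : ℝ, κ * powScale (3 / 16) β ≤ b ∧ b ^ 2 ≤ ε * θ * bareLambda ((L : ℝ) ^ 3 * β) / 16) ∧
      (∃ β0 : ℝ, ∀ β : ℝ, β0 ≤ β → ((L : ℝ) ^ 3 * β) ^ (-(1 / 5 : ℝ)) ≤ Real.pi * powScale (3 / 16) β / (2 * Real.sqrt 2 * (L : ℝ) ^ 3)) ∧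
      (∀ M : ℝ, ∃ β0 : ℝ, ∀ β : ℝ, β0 ≤ β → M * bareLambda ((L : ℝ) ^ 3 * β) ≤ powScale (3 * (3 / 16) / 2) β / 40) ∧
      ScalesAdmissible L (powScale (3 / 16)) (powScale (3 / 16)) :=
  (oneSiteRoute_window_typed_iff hL (3 / 16)).2 ⟨by norm_num, by norm_num⟩

/-- … and FAIL together at the record `s = 1/5` with the typed threshold `a = 1/5`, for every `L ≥ 2`. [folklore] -/
theorem record_fifth_fails (hL : 2 ≤ L) :
    ¬ ((∀ κ ε θ : ℝ, 0 < κ → 0 < ε → 0 < θ → ∃ β0 : ℝ, ∀ β : ℝ, β0 ≤ β →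
          ∃ b : ℝ, κ * powScale (1 / 5) β ≤ b ∧ b ^ 2 ≤ ε * θ * bareLambda ((L : ℝ) ^ 3 * β) / 16) ∧
      (∃ β0 : ℝ, ∀ β : ℝ, β0 ≤ β → ((L : ℝ) ^ 3 * β) ^ (-(1 / 5 : ℝ)) ≤ Real.pi * powScale (1 / 5) β / (2 * Real.sqrt 2 * (L : ℝ) ^ 3)) ∧
      (∀ M : ℝ, ∃ β0 : ℝ, ∀ β : ℝ, β0 ≤ β → M * bareLambda ((L : ℝ) ^ 3 * β) ≤ powScale (3 * (1 / 5) / 2) β / 40) ∧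
      ScalesAdmissible L (powScale (1 / 5)) (powScale (1 / 5))) := by
  rw [oneSiteRoute_window_typed_iff hL (1 / 5)]
  norm_num

/-- … and at the budget borderline `s = 1/6` (BUDGET fails once `κ` is quantified), for every `L ≥ 1` and any threshold. [folklore] -/
theorem sixth_fails_budget :
    ¬ (∀ κ ε θ : ℝ, 0 < κ → 0 < ε → 0 < θ → ∃ β0 : ℝ, ∀ β : ℝ, β0 ≤ β →
          ∃ b : ℝ, κ * powScale (1 / 6) β ≤ b ∧ b ^ 2 ≤ ε * θ * bareLambda ((L : ℝ) ^ 3 * β) / 16) := by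
  rw [offDiag_budget_forall_iff (L := L)]
  norm_num

end Window

/-! ## §4 The stiff layer of a pointwise cell comparison, across the window -/

section Cells

/-- A pointwise frozen-Gaussian cell comparison (R24b §5: window `s < (4q − 2)/9` on the stiff layer `|w|² ≤ β^{−q}`) is available on SOME proper layer `q < 1`
iff `s < 2/9` — the same right end as GAIN. [folklore] -/
theorem cell_layer_exists_iff {s : ℝ} : (∃ q : ℝ, q < 1 ∧ s < (4 * q - 2) / 9) ↔ s < 2 / 9 := by
  constructor
  · rintro ⟨q, hq, h⟩
    linarith
  · intro h
    refine ⟨((9 * s + 2) / 4 + 1) / 2, by linarith, by linarith⟩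

/-- The layer exponent needed at core exponent `s`: `s < (4q − 2)/9 ↔ (9s + 2)/4 < q`. [folklore] -/
theorem cell_layer_iff {s q : ℝ} : s < (4 * q - 2) / 9 ↔ (9 * s + 2) / 4 < q := by
  constructor <;> intro h <;> linarith

/-- Record layers across the typed window: `q > 59/64` at `s = 3/16`, `q > 13/14` at `s = 4/21`, `q > 19/20` at the (excluded) record `s = 1/5`; all above the
core-window entry `7/8` (R24b `cell_window_meets_core_iff`). [folklore] -/
theorem cell_layer_records :
    (9 * (3 / 16 : ℝ) + 2) / 4 = 59 / 64 ∧ (9 * (4 / 21 : ℝ) + 2) / 4 = 13 / 14 ∧ (9 * (1 / 5 : ℝ) + 2) / 4 = 19 / 20 ∧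
      (7 / 8 : ℝ) < 59 / 64 ∧ (59 / 64 : ℝ) < 13 / 14 ∧ (13 / 14 : ℝ) < 19 / 20 := by
  norm_num

end Cells

end Summit.QuantumFields.YangMills.Theorems.TwistedTraceScaling.Negative.R25
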